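import Summits.KontsevichZagierPeriods.KontsevichZagierPeriods.Theses.EulerFormChain
import Summits.KontsevichZagierPeriods.KontsevichZagierPeriods.Theorems.FurushoPentagonSectorToKernelOfLeaves
import Summits.KontsevichZagierPeriods.KontsevichZagierPeriods.Theorems.HurwitzMicroSectorsNormalFormPrincipleSplitGlue

/-!
# `PiPowerStratumOfSubs` (stmt-KontsevichZagierPeriods-17590, route EulerFormChain) — proof

`PiPowerStratumOfSubs : CubeResolution → AyoubCubeLocalKernel → AyoubPiCancellation → PiPowerStratum` is
the split glue of the deciding crux `PiPowerStratum` (stmt-KontsevichZagierPeriods-11792, the Tate stratum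
of Conjecture 1: two KZ-rational representations with the same value `q·π^k` are KZ-equivalent) into

* **X₁ = `CubeResolution`** (stmt-17978, geometry inside the rules): every integral representation is
  congruent modulo `KZ.relations` to a `ℤ`-combination of tame cube classes `[[0,1]ⁿ, f]`;
* **X₂ = `AyoubCubeLocalKernel`** (stmt-19074, the transcendence core on Ayoub-admissible cube classes
  after inverting `[π]`): an admissible cube class `[s]` with `∫ s = 0` has a disc-power multiple
  `([π]⋆)^N [s] ∈ KZ.relations` for every pinned disc product `P`;
* **X₃ = `AyoubPiCancellation`** (stmt-0540): `[π] ⋆ c ∈ relations → c ∈ relations`.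

Proof (the "of cubes" seam through the `π`-local kernel and `π`-cancellation). Given KZ-rational `r`,
`r'` of equal value: (1) RESOLVE both into the tame cubical span (X₁); (2) MERGE the difference of the
two resolutions to ONE tame cube class `[t]` (`ReducedPeriodRing.stub_cubeMerge`, landed) and make it
Ayoub-ADMISSIBLE inside the moves, `[t] ≡ [s]` (`SectorToKernel.stub_admissibleOfTame`, landed); (3) its
integral is `r.value − r'.value = 0` by SOUNDNESS (`KZ.relations_le_ker_eval_holds`); (4) X₂ gives
`([π]⋆)^N [s] ∈ relations` for the pinned disc product, which EXISTS
(`HurwitzMicroSectors.NormalFormPrincipleSplitGlue.exists_pinnedProduct`, landed); (5) X₃ peels the `N`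
discs by induction on `N` (`piPeel_of_ayoubPiCancellation`); (6) the five congruences add up to
`[r] − [r'] ∈ relations` (`equivalent_of_value_eq_of_cubes`). The rationality and `π`-power hypotheses of
`PiPowerStratum` are idle. Strategist-proved glue
(`Cruxes/PiPowerStratum/GlueByName.lean`, `piPowerStratum_of_subs`), landed by lead c10 of crux
stmt-KontsevichZagierPeriods-9129 (banking). References: M. Kontsevich, D. Zagier, *Periods* (2001),
§1.2, §4.1; J. Ayoub, EMS Newsl. 91 (2014), Def. 9–10, Prop. 11; J. Ayoub, Ann. of Math. 181 (2015),
Conj. 1.1; A. Huber, S. Müller-Stach, *Periods and Nori Motives* (2017), §13.1–13.2.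
-/

noncomputable section

namespace Summit.KontsevichZagierPeriods.EulerFormChain

open Literature.NumberTheory.Transcendental
open Literature.NumberTheory.Transcendental.KZ hiding cubicalSpan
open Summit.KontsevichZagierPeriods.FurushoPentagon.ReducedPeriodRing (unitCube cubicalGens cubicalSpan
  stub_cubeMerge)
open Summit.KontsevichZagierPeriods.FurushoPentagon.SectorToKernel
open Summit.KontsevichZagierPeriods.KontsevichZagierPeriods.Theses.EulerFormChain
  (CubeResolution AyoubCubeLocalKernel AyoubPiCancellation)

/-- **π-peeling**: under `AyoubPiCancellation` (stmt-0540), `([π]⋆)^[N] x ∈ relations → x ∈ relations`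
for the pinned disc product `P`, by induction on `N`. [folklore] -/
theorem piPeel_of_ayoubPiCancellation (h₃ : AyoubPiCancellation)
    (P : ∀ n : ℕ, IntegralRep n → IntegralRep (n + 2))
    (hP : ∀ (n : ℕ) (r : IntegralRep n), (P n r).domain = {z : Fin (n + 2) → ℝ | z 0 ^ 2 + z 1 ^ 2 ≤ 1 ∧
        (fun i : Fin n => z i.succ.succ) ∈ r.domain} ∧
      (P n r).integrand = fun z => r.integrand (fun i : Fin n => z i.succ.succ)) :
    ∀ (N : ℕ) (x : FormalRep),
      (⇑(FreeAbelianGroup.lift (fun t : (Σ n, IntegralRep n) => of (P t.1 t.2))))^[N] x ∈ relations →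
        x ∈ relations := by
  intro N
  induction N with
  | zero => intro x hx; simpa using hx
  | succ N ih =>
      intro x hx
      rw [Function.iterate_succ_apply'] at hx
      exact ih x (h₃ P hP _ hx)

/-- **Equal values ⇒ KZ-equivalent, through the cubes seam** (`CubeResolution`, `AyoubCubeLocalKernel`,
`AyoubPiCancellation`; items stmt-17978, stmt-19074, stmt-0540): resolve both representations, merge,
make admissible, soundness, the localised kernel on the admissible class, peel the discs, add up. No
rationality or `π`-power hypothesis is used. [folklore] -/
theorem equivalent_of_value_eq_of_cubes (h₁ : CubeResolution) (h₂ : AyoubCubeLocalKernel)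
    (h₃ : AyoubPiCancellation) {n m : ℕ} (r : IntegralRep n) (r' : IntegralRep m)
    (hv : r.value = r'.value) : KZ.Equivalent r r' := by
  obtain ⟨P, hP⟩ :=
    Summit.KontsevichZagierPeriods.HurwitzMicroSectors.NormalFormPrincipleSplitGlue.exists_pinnedProduct
  -- (1) resolve both representations into the tame cubical span
  obtain ⟨a, ha, hra⟩ := h₁ n r
  obtain ⟨a', ha', hra'⟩ := h₁ m r'
  -- (2) merge the difference to one tame cube class `t`, then to an admissible class `s`
  have hc : a - a' ∈ cubicalSpan := cubicalSpan.sub_mem ha ha'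
  obtain ⟨k, t, htd, hta, hct⟩ := stub_cubeMerge (a - a') hc
  rw [leaves_unitCube_eq_cube] at htd hta
  obtain ⟨s, hsd, hadm, hts⟩ := stub_admissibleOfTame k t htd hta
  -- (3) soundness: `s.value = 0`
  have hs0 : s.value = 0 := by
    have e1 : eval (of r - a) = 0 := relations_le_ker_eval_holds hra
    have e2 : eval (of r' - a') = 0 := relations_le_ker_eval_holds hra'
    have e3 : eval (a - a' - of t) = 0 := relations_le_ker_eval_holds hct
    have e4 : eval (of t - of s) = 0 := relations_le_ker_eval_holds hts
    simp only [map_sub, eval_of] at e1 e2 e3 e4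
    linarith
  -- (4) the localised kernel on the admissible cube class
  obtain ⟨N, hN⟩ := h₂ P hP k s hsd hadm hs0
  -- (5) peel the discs
  have hs : of s ∈ relations := piPeel_of_ayoubPiCancellation h₃ P hP N (of s) hN
  -- (6) add up
  show of r - of r' ∈ relations
  have key : of r - of r' = (of r - a) - (of r' - a') + (a - a' - of t) + (of t - of s) + of s := by
    abel
  rw [key]
  exact relations.add_mem (relations.add_mem (relations.add_mem (relations.sub_mem hra hra') hct) hts) hs

/-- **`PiPowerStratumOfSubs`** (route EulerFormChain, stmt-KontsevichZagierPeriods-17590):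
`CubeResolution → AyoubCubeLocalKernel → AyoubPiCancellation → PiPowerStratum` — for KZ-rational `r`, `r'`
of equal value (`q·π^k`, idle) the cubes seam `equivalent_of_value_eq_of_cubes` (resolve, merge,
admissible, soundness, `π`-local kernel, peel, add up) gives `KZ.Equivalent r r'`. [folklore] -/
theorem piPowerStratumOfSubs_proof :
    Summit.KontsevichZagierPeriods.KontsevichZagierPeriods.Theses.EulerFormChain.PiPowerStratumOfSubs :=
  fun h₁ h₂ h₃ _ _ r r' _ _ hv _ => equivalent_of_value_eq_of_cubes h₁ h₂ h₃ r r' hv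

end Summit.KontsevichZagierPeriods.EulerFormChain

end
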